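import Literature.AnabelianGeometry.AbsoluteAnabelian.MonoidKummerGaloisCyclotomeHomComposition
import Literature.AnabelianGeometry.AbsoluteAnabelian.MonoidKummerEndomorphismsArePowers
import HarnessLib

/-!
# [AbsTopIII] Prop 3.2 (ii.4) over the identity of `G_k`: the coefficient square holds IFF `φ_M = 𝟙`

S. Mochizuki, *Topics in Absolute Anabelian Geometry III*, §3 (bib key `MochizukiAbsTopIII2015`, lit key
`paper:url-5493eb38cbb7`): Def. 3.1 (ii)/(iii) p. 67, Prop. 3.2 (ii) p. 71 l. 58 – p. 72 l. 6 («the «`μ_Ẑ(M_TM)`»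
may be replaced by «`μ_Ẑ(G)`» [cf. Remark 3.2.1 below]»), Prop. 3.2 (iv) p. 72.

THE POINT (abc-iut cell, layer L4, node AbsTopIII:Prop3.2(ii), clause (ii.4)).  For an ENDOMORPHISM
`φ = (φ_Π, φ_M)` of a model MLF-Galois `TM`-pair `(Π ↷ 𝒪_k̄^⊳)` in `𝒞^MLF_TM` COVERING THE IDENTITY of `G_k`
(`ε ∘ φ_Π = ε`; e.g. `φ_Π = 𝟙`, or any `φ_Π` over `id_{G_k}`):

* `homM_smul_of_overId`: `φ_M` is a `G_k`-equivariant monoid endomorphism of `𝒪_k̄^⊳` over `id_{G_k}`, hence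
  (abc-iut-L4-t2 `MLFClosure.nonzeroIntegers_monoidHom_eq_pow`, sibling file) **`φ_M = (x ↦ xᴹ)` for one
  `M ∈ ℕ`** — `exists_homM_eq_pow`, `exists_homM_eq_powEnd_homM`: over `id_{G_k}` the endomorphisms of the model
  pair in print's category are EXACTLY abc-iut-L4-t9's power endomorphisms `powEnd M` on the monoid side;
* `galoisHom_eq_self_of_overId`, `muZhatMap_eq_self_of_overId`: `β(φ) = 𝟙` and `μ_Ẑ(β(φ)) = 𝟙`;
* `not_surjective_cyclotome_map_pow` (`M ≥ 2`), `not_injective_cyclotome_map_pow_zero`: `Λ(u ↦ uᴹ)` is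
  bijective on `Λ(k̄ˣ) = Ẑ(1)` only for `M = 1` (`M ∉ Ẑˣ` otherwise);
* **`coeffSquare_iff_homM_eq_id_of_overId`**: Prop. 3.2 (ii)'s coefficient square `hsq(φ; R, R)` (the
  hypothesis of abc-iut-w5-d201's `pullMuZhat_kummerMuZhat_eq_pushMuZhat_of_square`, any reciprocity data `R`)
  HOLDS IFF `φ_M = 𝟙` — so over `id_{G_k}` the `hsq`-subcategory of abc-iut-L4-t2's
  `MonoidKummerGaloisCyclotomeHomComposition` (p495791) meets `End((Π ↷ 𝒪_k̄^⊳))` exactly in the monoid-identity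
  endomorphisms, and the NECESSARY condition «`Λ(φ_M^gp)` bijective on `Ẑ(1)`» of that file is also SUFFICIENT
  here (`coeffSquare_iff_bijective_cyclotome_map_of_overId`).

No definition, no `Prop`-valued definition, no instance.  Universe `0`.
HONEST FRAMING: classical Kummer theory over the cell's model pairs; a statement about the cell's typed category
of [AbsTopIII] Def. 3.1; nothing here bears on [IUTchIII] Cor. 3.12; no side is taken; nothing asserts that
abc is proved or refuted.
-/

noncomputable section

open scoped nonZeroDivisors

namespace Literature.AnabelianGeometry.AbsoluteAnabelian

open Function Field
open Literature.NumberTheory.GaloisRepresentations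

/-! ### §1 `Λ(u ↦ uᴹ)` on `Ẑ(1)` is bijective only for `M = 1` -/

namespace MLFClosure

variable (C : MLFClosure.{0})

/-- The compatible system `n ↦ x_nᴹ` attached to a compatible system of roots `x` of a primitive `M`-th root of
unity `ζ` lies in `Λ(k̄ˣ)` and has `M`-component `ζ`. [cite: MochizukiAbsTopIII2015, Remark 3.2.1 p.73] -/
private theorem exists_cyclotome_apply_eq {M : ℕ} (hM : 0 < M) {ζ : (C.K)ˣ} (hζ : ζ ^ M = 1) :
    ∃ η : EtaleTheta.cyclotome (C.K)ˣ, (η : ℕ+ → (C.K)ˣ) ⟨M, hM⟩ = ζ := by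
  let x : EtaleTheta.RootSystem ζ := EtaleTheta.RootSystem.ofRootableBy _
  refine ⟨⟨fun n => x.root n ^ M,
    ⟨fun n => by
      show (x.root n ^ M) ^ (n : ℕ) = 1
      rw [← pow_mul, mul_comm M (n : ℕ), pow_mul, x.pow_self, hζ],
     fun n m => by
      show (x.root (n * m) ^ M) ^ (m : ℕ) = x.root n ^ M
      rw [← pow_mul, mul_comm M (m : ℕ), pow_mul, x.root_mul_pow]⟩⟩, ?_⟩
  show x.root ⟨M, hM⟩ ^ M = ζ
  exact x.pow_self ⟨M, hM⟩

/-- **`Λ(u ↦ uᴹ)` is NOT surjective on `Λ(k̄ˣ) = Ẑ(1)` for `M ≥ 2`**: the system `n ↦ x_nᴹ` over a primitive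
`M`-th root of unity `ζ` has `M`-component `ζ ≠ 1`, while the `M`-component of an `M`-th power in `Λ(k̄ˣ)` is `1`.
[cite: MochizukiAbsTopIII2015, Remark 3.2.1 p.73] -/
theorem not_surjective_cyclotome_map_pow {M : ℕ} (hM : 2 ≤ M) :
    ¬ Surjective (EtaleTheta.cyclotome.map (powMonoidHom M : (C.K)ˣ →* (C.K)ˣ)) := by
  haveI : IsAlgClosed C.K := IsAlgClosure.isAlgClosed C.k
  haveI : CharZero C.K := charZero_of_injective_algebraMap (algebraMap C.k C.K).injective
  haveI : NeZero M := ⟨by omega⟩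
  intro hs
  obtain ⟨ζ, hζ⟩ := HasEnoughRootsOfUnity.exists_primitiveRoot C.K M
  have hζu := hζ.isUnit (by omega)
  have hζM : hζu.unit ^ M = 1 := Units.ext (by rw [Units.val_pow_eq_pow_val, IsUnit.unit_spec, hζ.pow_eq_one,
    Units.val_one])
  obtain ⟨η, hη⟩ := C.exists_cyclotome_apply_eq (by omega) hζM
  obtain ⟨ξ, hξ⟩ := hs η
  have h1 : ((ξ : ℕ+ → (C.K)ˣ) ⟨M, by omega⟩) ^ M = hζu.unit := by
    have := congrArg (fun θ : EtaleTheta.cyclotome (C.K)ˣ => (θ : ℕ+ → (C.K)ˣ) ⟨M, by omega⟩) hξ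
    simpa only [EtaleTheta.cyclotome.map_apply, powMonoidHom_apply, hη] using this
  have h2 : ((ξ : ℕ+ → (C.K)ˣ) ⟨M, by omega⟩) ^ M = 1 := EtaleTheta.cyclotome.pow_eq_one ξ ⟨M, by omega⟩
  rw [h2] at h1
  exact hζ.ne_one hM (by rw [← IsUnit.unit_spec hζu, ← h1, Units.val_one])

/-- **`Λ(u ↦ u⁰)` is NOT injective on `Λ(k̄ˣ)`** (`Ẑ(1) ≠ 1`: the system over `-1` with `2`-component `-1`).
[cite: MochizukiAbsTopIII2015, Remark 3.2.1 p.73] -/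
theorem not_injective_cyclotome_map_pow_zero :
    ¬ Injective (EtaleTheta.cyclotome.map (powMonoidHom 0 : (C.K)ˣ →* (C.K)ˣ)) := by
  haveI : CharZero C.K := charZero_of_injective_algebraMap (algebraMap C.k C.K).injective
  intro hi
  obtain ⟨η, hη⟩ := C.exists_cyclotome_apply_eq (M := 2) two_pos (ζ := -1) (by rw [neg_one_sq])
  have h : η = 1 := hi (Subtype.ext (funext fun n => by
    simp only [EtaleTheta.cyclotome.map_apply, powMonoidHom_apply, pow_zero]))
  rw [h] at hη
  have h' : ((1 : (C.K)ˣ) : C.K) = ((-1 : (C.K)ˣ) : C.K) := congrArg Units.val hη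
  rw [Units.val_one, Units.val_neg, Units.val_one] at h'
  exact one_ne_zero (by linear_combination h' / 2 : (1 : C.K) = 0)

/-- **`Λ(u ↦ uᴹ)` is bijective on `Λ(k̄ˣ)` iff `M = 1`.** [cite: MochizukiAbsTopIII2015, Remark 3.2.1 p.73] -/
theorem bijective_cyclotome_map_pow_iff (M : ℕ) :
    Bijective (EtaleTheta.cyclotome.map (powMonoidHom M : (C.K)ˣ →* (C.K)ˣ)) ↔ M = 1 := by
  refine ⟨fun h => ?_, fun h => ?_⟩
  · by_contra hM
    rcases Nat.lt_or_ge M 2 with hlt | hge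
    · rcases Nat.lt_or_ge M 1 with h0 | h1
      · have : M = 0 := by omega
        subst this
        exact C.not_injective_cyclotome_map_pow_zero h.1
      · omega
    · exact C.not_surjective_cyclotome_map_pow hge h.2
  · subst h
    have : EtaleTheta.cyclotome.map (powMonoidHom 1 : (C.K)ˣ →* (C.K)ˣ) = MonoidHom.id _ :=
      MonoidHom.ext fun η => Subtype.ext (funext fun n => by
        simp only [EtaleTheta.cyclotome.map_apply, powMonoidHom_apply, pow_one, MonoidHom.id_apply])
    rw [this]
    exact bijective_id

end MLFClosure

/-! ### §2 Endomorphisms of a model `TM`-pair over the identity of `G_k` -/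

namespace GaloisMonoidPair.Hom

variable {C : MLFClosure.{0}} {D : ModelMLFGaloisData C.k C.K} (φ : GaloisMonoidPair.Hom D.tmPair D.tmPair)
  (hφ : ∀ g : D.Pi, D.aug (φ.homPi g) = D.aug g)

include hφ in
/-- Over `id_{G_k}`, `φ_M` is `G_k`-EQUIVARIANT in the shape of `MLFClosure.nonzeroIntegers_monoidHom_eq_pow`:
`φ_M(σ • x) = σ • φ_M(x)`. [cite: MochizukiAbsTopIII2015, Definition 3.1 (ii) p.67] -/
theorem homM_smul_of_overId (σ : C.K ≃ₐ[C.k] C.K) (x : ↥(nonzeroIntegers C.k C.K)) :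
    (φ.homM ⟨σ • (x : C.K), smul_mem_nonzeroIntegers σ x.2⟩ : C.K) = σ • (φ.homM x : C.K) := by
  obtain ⟨g, rfl⟩ := D.aug_surjective σ
  have h := congrArg Subtype.val (φ.smul_comm g x)
  rw [ModelMLFGaloisData.nonzeroIntegers_coe_smul, hφ] at h
  exact h

include hφ in
/-- **Over `id_{G_k}`, `φ_M` is a POWER MAP `x ↦ xᴹ`.** [cite: MochizukiAbsTopIII2015, Proposition 3.2 (iv) p.72] -/
theorem exists_homM_eq_pow : ∃ M : ℕ, ∀ x : ↥(nonzeroIntegers C.k C.K), φ.homM x = x ^ M :=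
  MLFClosure.nonzeroIntegers_monoidHom_eq_pow φ.homM (homM_smul_of_overId φ hφ)

include hφ in
/-- **Over `id_{G_k}`, `φ_M = (powEnd M)_M`** for one `M ∈ ℕ` (abc-iut-L4-t9's power endomorphisms exhaust the
monoid components over the identity). [cite: MochizukiAbsTopIII2015, Definition 3.1 (ii) p.67] -/
theorem exists_homM_eq_powEnd_homM :
    ∃ M : ℕ, φ.homM = GaloisMonoidPair.Hom.homM (GaloisMonoidPair.powEnd D.tmPair M) := by
  obtain ⟨M, hM⟩ := exists_homM_eq_pow φ hφ
  exact ⟨M, MonoidHom.ext fun x => by rw [hM, GaloisMonoidPair.powEnd_homM_apply]⟩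

include hφ in
/-- Over `id_{G_k}`: `β(φ) = 𝟙` on `Gal(k̄/k)`. [cite: MochizukiAbsTopIII2015, Definition 3.1 (ii) p.67] -/
theorem galoisHom_eq_self_of_overId (σ : C.K ≃ₐ[C.k] C.K) : φ.galoisHom σ = σ :=
  (φ.eq_galoisHom_of_aug (MonoidHom.id _) (fun g => (hφ g).symm) σ).symm

include hφ in
/-- Over `id_{G_k}`: `β(φ) = 𝟙` on the absolute Galois group. [cite: MochizukiAbsTopIII2015, Definition 3.1 (ii) p.67] -/
theorem absGaloisHom_eq_self_of_overId (h : IsOpenMap D.aug) (σ : absoluteGaloisGroup C.k) :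
    φ.absGaloisHom h σ = σ := by
  change algEquivContinuousMulEquivAbsoluteGaloisGroup C.k C.K
      (φ.galoisHom ((algEquivContinuousMulEquivAbsoluteGaloisGroup C.k C.K).symm σ)) = σ
  rw [galoisHom_eq_self_of_overId φ hφ, ContinuousMulEquiv.apply_symm_apply]

include hφ in
/-- Over `id_{G_k}`: **`μ_Ẑ(β(φ)) = 𝟙`** (Cor. 1.10 (i) along the identity). [cite: MochizukiAbsTopIII2015, Cor 1.10 (i) p.42] -/
theorem muZhatMap_eq_self_of_overId (h : IsOpenMap D.aug) (ζ : muZhat (absoluteGaloisGroup C.k)) :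
    φ.muZhatMap h h ζ = ζ := by
  have hid : φ.absGaloisHom h =
      ((ContinuousMulEquiv.refl (absoluteGaloisGroup C.k) :
        absoluteGaloisGroup C.k ≃ₜ* absoluteGaloisGroup C.k) :
          absoluteGaloisGroup C.k →ₜ* absoluteGaloisGroup C.k) :=
    ContinuousMonoidHom.ext fun σ => absGaloisHom_eq_self_of_overId φ hφ h σ
  have hinj : Injective ((ContinuousMulEquiv.refl (absoluteGaloisGroup C.k) :
        absoluteGaloisGroup C.k ≃ₜ* absoluteGaloisGroup C.k) :
          absoluteGaloisGroup C.k →ₜ* absoluteGaloisGroup C.k) := fun _ _ e => e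
  have hopen : IsOpen (Set.range ((ContinuousMulEquiv.refl (absoluteGaloisGroup C.k) :
        absoluteGaloisGroup C.k ≃ₜ* absoluteGaloisGroup C.k) :
          absoluteGaloisGroup C.k →ₜ* absoluteGaloisGroup C.k)) := by
    rw [← hid]
    exact φ.isOpen_range_absGaloisHom h h
  rw [muZhatMap, muZhat.mapOfOpenEmbedding_congr_hom hid (φ.absGaloisHom_injective h)
    (φ.isOpen_range_absGaloisHom h h) hinj hopen,
    muZhat.mapOfOpenEmbedding_coe_continuousMulEquiv _ hinj hopen]
  exact Subtype.ext (funext fun n => by rw [muZhat.map_apply_coe, muQZ.map_refl, ofAdd_toAdd])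

/-- `(x ↦ xᴹ)^gp = (u ↦ uᴹ)` on `k̄ˣ`. [cite: MochizukiAbsTopIII2015, Definition 3.1 (iii) p.68] -/
theorem unitsLift_eq_powMonoidHom_of_eq_pow {M : ℕ} (hM : ∀ x : ↥(nonzeroIntegers C.k C.K), φ.homM x = x ^ M) :
    ModelMLFGaloisData.unitsLift φ.homM = powMonoidHom M :=
  (ModelMLFGaloisData.unitsLift_unique _ (powMonoidHom M) fun m => by
    rw [powMonoidHom_apply, hM, ← ModelMLFGaloisData.toUnitHom_apply, ← ModelMLFGaloisData.toUnitHom_apply,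
      map_pow]).symm

include hφ in
/-- **[AbsTopIII] Prop 3.2 (ii.4) over `id_{G_k}`: the coefficient square holds IFF `Λ(φ_M^gp)` is bijective on
`Ẑ(1)`** — SUFFICIENCY of the necessary condition of `MonoidKummerGaloisCyclotomeHomComposition`
(`bijective_cyclotome_map_unitsLift_of_coeffSquare`) in the over-identity case, for any reciprocity data `R`.
[cite: MochizukiAbsTopIII2015, Proposition 3.2 (ii) p.72] -/
theorem coeffSquare_iff_bijective_cyclotome_map_of_overId (h : IsOpenMap D.aug) (R : TorsionReciprocityData C.k) :
    (∀ ζ : muZhat (absoluteGaloisGroup C.k),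
      EtaleTheta.cyclotome.map (ModelMLFGaloisData.rootsHom C R) (φ.muZhatMap h h ζ) =
        EtaleTheta.cyclotome.map (ModelMLFGaloisData.unitsLift φ.homM)
          (EtaleTheta.cyclotome.map (ModelMLFGaloisData.rootsHom C R) ζ)) ↔
    Bijective (EtaleTheta.cyclotome.map (ModelMLFGaloisData.unitsLift φ.homM)) := by
  refine ⟨bijective_cyclotome_map_unitsLift_of_coeffSquare φ h h R R, fun hb ζ => ?_⟩
  obtain ⟨M, hM⟩ := exists_homM_eq_pow φ hφ
  have hL := unitsLift_eq_powMonoidHom_of_eq_pow φ hM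
  rw [hL] at hb ⊢
  have hM1 : M = 1 := (MLFClosure.bijective_cyclotome_map_pow_iff C M).mp hb
  subst hM1
  rw [muZhatMap_eq_self_of_overId φ hφ h]
  exact Subtype.ext (funext fun n => by
    simp only [EtaleTheta.cyclotome.map_apply, powMonoidHom_apply, pow_one])

include hφ in
/-- **[AbsTopIII] Prop 3.2 (ii.4) over `id_{G_k}`: the coefficient square `hsq(φ; R, R)` HOLDS IFF `φ_M = 𝟙`.**
For an endomorphism `φ` of a model MLF-Galois `TM`-pair `(Π ↷ 𝒪_k̄^⊳)` in `𝒞^MLF_TM` covering the identity of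
`G_k` (open augmentation) and any reciprocity data `R`: the `μ_Ẑ(G)`-valued Kummer maps of Prop. 3.2 (ii) are
compatible with `φ` through the group-theoretic `μ_Ẑ(β(φ)) = 𝟙` exactly when `φ_M` is the identity — the
`hsq`-subcategory (abc-iut-L4-t2 p495791) meets `End((Π ↷ 𝒪_k̄^⊳))` over `id_{G_k}` in `{φ : φ_M = 𝟙}`, all other
endomorphisms being the power maps `x ↦ xᴹ`, `M ≠ 1` (finding E-L4-10 in final form).
[cite: MochizukiAbsTopIII2015, Proposition 3.2 (ii) p.72] -/
theorem coeffSquare_iff_homM_eq_id_of_overId (h : IsOpenMap D.aug) (R : TorsionReciprocityData C.k) :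
    (∀ ζ : muZhat (absoluteGaloisGroup C.k),
      EtaleTheta.cyclotome.map (ModelMLFGaloisData.rootsHom C R) (φ.muZhatMap h h ζ) =
        EtaleTheta.cyclotome.map (ModelMLFGaloisData.unitsLift φ.homM)
          (EtaleTheta.cyclotome.map (ModelMLFGaloisData.rootsHom C R) ζ)) ↔
    φ.homM = MonoidHom.id _ := by
  rw [coeffSquare_iff_bijective_cyclotome_map_of_overId φ hφ h R]
  obtain ⟨M, hM⟩ := exists_homM_eq_pow φ hφ
  rw [unitsLift_eq_powMonoidHom_of_eq_pow φ hM, MLFClosure.bijective_cyclotome_map_pow_iff C M]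
  constructor
  · rintro rfl
    exact MonoidHom.ext fun x => by rw [hM, pow_one, MonoidHom.id_apply]
  · intro hid
    haveI : CharZero C.K := charZero_of_injective_algebraMap (algebraMap C.k C.K).injective
    -- `x ↦ xᴹ` is the identity on `𝒪_k̄^⊳` only for `M = 1`: test at `2`
    have htwo : (2 : C.K) ∈ nonzeroIntegers C.k C.K :=
      ⟨by simp, two_ne_zero⟩
    have h2 := congrArg Subtype.val ((hM ⟨2, htwo⟩).symm.trans (by rw [hid, MonoidHom.id_apply]))
    rw [SubmonoidClass.coe_pow] at h2
    -- `2 ^ M = 2` in characteristic `0` forces `M = 1`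
    have h2' : ((2 : ℕ) : C.K) ^ M = ((2 : ℕ) : C.K) ^ 1 := by simpa using h2
    rw [← Nat.cast_pow, ← Nat.cast_pow, Nat.cast_inj] at h2'
    exact Nat.pow_right_injective le_rfl h2'

include hφ in
/-- **Consequently: along an endomorphism over `id_{G_k}` with `φ_M ≠ 𝟙`, Prop. 3.2 (ii)'s coefficient square
FAILS for every reciprocity data** (generalising `ModelMLFGaloisData.not_coeffSquare_powEnd_two` from `M = 2`
to every `M ≠ 1`). [cite: MochizukiAbsTopIII2015, Proposition 3.2 (ii) p.72] -/
theorem not_coeffSquare_of_overId_of_homM_ne_id (h : IsOpenMap D.aug) (R : TorsionReciprocityData C.k)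
    (hne : φ.homM ≠ MonoidHom.id _) :
    ¬ ∀ ζ : muZhat (absoluteGaloisGroup C.k),
      EtaleTheta.cyclotome.map (ModelMLFGaloisData.rootsHom C R) (φ.muZhatMap h h ζ) =
        EtaleTheta.cyclotome.map (ModelMLFGaloisData.unitsLift φ.homM)
          (EtaleTheta.cyclotome.map (ModelMLFGaloisData.rootsHom C R) ζ) :=
  fun hsq => hne ((coeffSquare_iff_homM_eq_id_of_overId φ hφ h R).mp hsq)

end GaloisMonoidPair.Hom

end Literature.AnabelianGeometry.AbsoluteAnabelian

end
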